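import Literature.NumberTheory.Automorphic.UnboundedDenominatorsLambdaProofs
import HarnessLib

/-!
# The unbounded denominators theorem (Calegari–Dimitrov–Tang) — §4.2: `M_2 = ℂ(λ)`

PROOF-ONLY sequel (no definition, no named fact; D-0026) of `UnboundedDenominatorsLambdaProofs.lean`
(`λ ∈ levelField 2`). Source: F. Calegari, V. Dimitrov, Y. Tang, *The unbounded denominators
conjecture*, J. Amer. Math. Soc. **38** (2025), 627–702 = arXiv:2109.09040, §4.2 (after
Definition 4.2.1): "the `ℚ(λ)`-vector space generated by such elements inside `ℚ((q^{1/N}))` is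
`M_2 = ℚ(λ)`" — `λ` is a Hauptmodul for `Γ(2)`.

## What is proved

* `modFun_mul_pow_eq_polynomial` — every generator `u = F/Δᵐ` of `M_2` (`F ∈ M_{12m}(G)`,
  `G ⊇ Γ(2)`) satisfies `u · (λ(1−λ))^{2m} = P(λ)` for a polynomial `P` (tree
  `ModularLambda.exists_polynomial_of_Gamma_two_invariant_of_forall`, the Laurent-polynomial theorem
  for `Γ(2)`-invariant holomorphic functions of exponential type at the cusps; the growth
  `|u(g•z)| ≤ M e^{2πm Im z}` comes from boundedness of `F ∣ g` and `|Δ| ≫ e^{−2π Im z}` at `i∞`);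
* ★ `levelField_two_eq_adjoin` — **`M_2 = ℂ(λ)`**: `levelField 2 = ℂ⟮λ⟯` for the element `λ` of
  `Mer` provided by `exists_modularLambda_mem_levelField_two`; in particular `M_2` is finitely
  generated (`fg_levelField_two`).

## References

* [CalegariDimitrovTang2025] F. Calegari, V. Dimitrov, Y. Tang, The unbounded denominators
  conjecture, J. Amer. Math. Soc. 38 (2025), no. 3, 627–702; arXiv:2109.09040. §4.2 (`M_2 = ℚ(λ)`).
-/

noncomputable section

namespace Literature.NumberTheory.Automorphic

open scoped MatrixGroups ModularForm Manifold
open UpperHalfPlane CongruenceSubgroup Matrix.SpecialLinearGroup ModularGroup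
open Literature.NumberTheory.EllipticCurves.JacobiThetaNull ModularLambda

namespace UnboundedDenominators

/-! ### §1. Generators of `M_2` are rational functions of `λ` -/

/-- **Growth of `F/Δᵐ` at the cusps**: for `F ∈ M_{12m}(G)` (`G ≤ SL(2, ℤ)` of finite index) and
`g ∈ SL(2, ℤ)`, `‖(F/Δᵐ)(g • z)‖ ≤ M e^{π(2m) Im z}` high up (`F ∣ g` is bounded at `i∞`,
`Δ ∣ g = Δ` and `|Δ(z)| ≫ e^{−2π Im z}`). [folklore] -/
private theorem exists_growth_modFun {G : Subgroup SL(2, ℤ)} [G.FiniteIndex] {m : ℕ}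
    (F : ModularForm (G : Subgroup (GL (Fin 2) ℝ)) (12 * (m : ℤ))) (g : SL(2, ℤ)) :
    ∃ B M : ℝ, ∀ z : ℍ, B ≤ z.im →
      ‖(modFun m F : ℍ → ℂ) (g • z)‖ ≤ M * Real.exp (Real.pi * ((2 * m : ℕ) : ℝ) * z.im) := by
  -- `F ∣ g` bounded at `i∞`
  obtain ⟨M₁, A₁, hM₁⟩ := isBoundedAtImInfty_iff.mp (ModularFormClass.bdd_at_infty_slash F g)
  -- `e^{-2π y} ≤ C |Δ|` high up
  obtain ⟨C, hC⟩ := Asymptotics.isBigO_iff.mp ModularForm.exp_isBigO_discriminant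
  obtain ⟨A₂, hA₂⟩ := (atImInfty_mem _).mp hC
  have hCpos : ∀ z : ℍ, A₂ ≤ z.im → 0 < C := by
    intro z hz
    have h := hA₂ z hz
    simp only [Set.mem_setOf_eq, Real.norm_eq_abs, abs_of_pos (Real.exp_pos _)] at h
    by_contra hle
    push Not at hle
    have : Real.exp (-2 * Real.pi * z.im) ≤ 0 :=
      h.trans (mul_nonpos_of_nonpos_of_nonneg hle (norm_nonneg _))
    exact absurd this (not_le.mpr (Real.exp_pos _))
  refine ⟨max A₁ A₂, max M₁ 0 * max C 0 ^ m, fun z hz ↦ ?_⟩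
  have hz₁ : A₁ ≤ z.im := (le_max_left _ _).trans hz
  have hz₂ : A₂ ≤ z.im := (le_max_right _ _).trans hz
  have hC0 : 0 < C := hCpos z hz₂
  -- `|Δ(z)| ≥ e^{-2πy}/C`
  have hΔ : Real.exp (-2 * Real.pi * z.im) ≤ C * ‖ModularForm.discriminant z‖ := by
    have h := hA₂ z hz₂
    simpa only [Set.mem_setOf_eq, Real.norm_eq_abs, abs_of_pos (Real.exp_pos _)] using h
  have hΔ0 : 0 < ‖ModularForm.discriminant z‖ := norm_pos_iff.mpr (ModularForm.discriminant_ne_zero z)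
  have hinvΔ : ‖ModularForm.discriminant z‖⁻¹ ≤ C * Real.exp (2 * Real.pi * z.im) := by
    rw [inv_le_iff_one_le_mul₀ hΔ0]
    have : 1 = Real.exp (-2 * Real.pi * z.im) * Real.exp (2 * Real.pi * z.im) := by
      rw [← Real.exp_add]; ring_nf; rw [Real.exp_zero]
    rw [this]
    calc Real.exp (-2 * Real.pi * z.im) * Real.exp (2 * Real.pi * z.im)
        ≤ C * ‖ModularForm.discriminant z‖ * Real.exp (2 * Real.pi * z.im) := by
          gcongr
      _ = C * Real.exp (2 * Real.pi * z.im) * ‖ModularForm.discriminant z‖ := by ring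
  -- `(F/Δᵐ)(g•z) = (F ∣ g)(z)/Δ(z)ᵐ`
  have hval : (modFun m F : ℍ → ℂ) (g • z) =
      ((⇑F : ℍ → ℂ) ∣[12 * (m : ℤ)] (g : GL (Fin 2) ℝ)) z / ModularForm.discriminant z ^ m := by
    have hΔg : ModularForm.discriminant (g • z) = denom g z ^ (12 : ℤ) * ModularForm.discriminant z := by
      have h := SlashInvariantForm.slash_action_eqn'' (CuspForm.discriminant)
        (γ := (g : GL (Fin 2) ℝ)) (MonoidHom.mem_range.mpr ⟨g, rfl⟩) z
      simpa only [CuspForm.coe_discriminant, sl_moeb] using h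
    have hd : denom g z ≠ 0 := denom_ne_zero g z
    rw [modFun_apply, ← ModularForm.SL_slash, ModularForm.SL_slash_apply, hΔg, mul_pow,
      ← zpow_natCast (denom g z ^ (12 : ℤ)), ← zpow_mul, zpow_neg]
    field_simp
  rw [hval, norm_div, norm_pow, div_eq_mul_inv, ← inv_pow]
  have hFg : ‖((⇑F : ℍ → ℂ) ∣[12 * (m : ℤ)] (g : GL (Fin 2) ℝ)) z‖ ≤ max M₁ 0 :=
    (hM₁ z hz₁).trans (le_max_left _ _)
  have hinv' : ‖ModularForm.discriminant z‖⁻¹ ≤ max C 0 * Real.exp (2 * Real.pi * z.im) :=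
    hinvΔ.trans (by gcongr; exact le_max_left _ _)
  have hexp : Real.exp (Real.pi * ((2 * m : ℕ) : ℝ) * z.im) = Real.exp (2 * Real.pi * z.im) ^ m := by
    rw [← Real.exp_nat_mul]
    congr 1
    push_cast
    ring
  calc ‖((⇑F : ℍ → ℂ) ∣[12 * (m : ℤ)] (g : GL (Fin 2) ℝ)) z‖ * ‖ModularForm.discriminant z‖⁻¹ ^ m
      ≤ max M₁ 0 * (max C 0 * Real.exp (2 * Real.pi * z.im)) ^ m := by
        gcongr
    _ = max M₁ 0 * max C 0 ^ m * Real.exp (Real.pi * ((2 * m : ℕ) : ℝ) * z.im) := by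
        rw [hexp, mul_pow, mul_assoc]
        ring

/-- **Generators of `M_2` are rational functions of `λ`**: for `F ∈ M_{12m}(G)` with `Γ(2) ≤ G`,
`(F/Δᵐ)(τ) · (λ(τ)(1 − λ(τ)))^{2m} = P(λ(τ))` on `ℍ` for a polynomial `P` of degree `≤ 6m`
(tree `exists_polynomial_of_Gamma_two_invariant_of_forall`: a `Γ(2)`-invariant holomorphic function
of exponential type `2m` at every cusp is a Laurent polynomial in the Hauptmodul `λ`).
[cite: CalegariDimitrovTang2025, §4.2 (`M_2 = ℚ(λ)`)] -/
theorem modFun_mul_pow_eq_polynomial {G : Subgroup SL(2, ℤ)} [G.FiniteIndex] (hG : Gamma 2 ≤ G)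
    {m : ℕ} (F : ModularForm (G : Subgroup (GL (Fin 2) ℝ)) (12 * (m : ℤ))) :
    ∃ P : Polynomial ℂ, P.natDegree ≤ 3 * (2 * m) ∧ ∀ τ : ℍ,
      (modFun m F : ℍ → ℂ) τ * (modularLambda τ ^ (2 * m) * (1 - modularLambda τ) ^ (2 * m)) =
        P.eval (modularLambda τ) := by
  let Fc : ℂ → ℂ := (modFun m F : ℍ → ℂ) ∘ ofComplex
  have hFc : ∀ z : ℍ, Fc (z : ℂ) = (modFun m F : ℍ → ℂ) z := fun z ↦ by
    simp only [Fc, Function.comp_apply, ofComplex_apply]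
  have hdiff : DifferentiableOn ℂ Fc {z : ℂ | 0 < z.im} :=
    UpperHalfPlane.mdifferentiable_iff.mp (modFun m F).2
  have hinv : ∀ γ ∈ CongruenceSubgroup.Gamma 2, ∀ z : ℍ, Fc ((γ • z : ℍ) : ℂ) = Fc z := by
    intro γ hγ z
    rw [hFc, hFc]
    exact modFun_apply_smul_of_mem F (hG hγ) z
  have hgr : ∀ g : SL(2, ℤ), ∃ B M : ℝ, ∀ z : ℍ, B ≤ z.im →
      ‖Fc ((g • z : ℍ) : ℂ)‖ ≤ M * Real.exp (Real.pi * ((2 * m : ℕ) : ℝ) * z.im) := by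
    intro g
    obtain ⟨B, M, h⟩ := exists_growth_modFun F g
    exact ⟨B, M, fun z hz ↦ by rw [hFc]; exact h z hz⟩
  obtain ⟨P, hdeg, hP⟩ := exists_polynomial_of_Gamma_two_invariant_of_forall (2 * m) hdiff hinv hgr
  refine ⟨P, hdeg, fun τ ↦ ?_⟩
  rw [← hFc]
  exact hP τ τ.im_pos

/-! ### §2. `M_2 = ℂ(λ)` -/

/-- ★ **`M_2 = ℂ(λ)`** [cite: CalegariDimitrovTang2025, §4.2 ("the `ℚ(λ)`-vector space generated
by such elements … is `M_2 = ℚ(λ)`")]: the tree's `levelField 2` is the simple extension `ℂ⟮λ⟯` of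
`ℂ` inside `Mer` generated by (the element of `Mer` given by) the modular function `λ`. (`⊇`:
`λ ∈ M_2`, `exists_modularLambda_mem_levelField_two`; `⊆`: every generator `F/Δᵐ` equals
`P(λ)/(λ(1−λ))^{2m}`, `modFun_mul_pow_eq_polynomial`.) -/
theorem levelField_two_eq_adjoin :
    ∃ L : hol, (L : ℍ → ℂ) = (fun τ : ℍ ↦ modularLambda τ) ∧
      levelField 2 = IntermediateField.adjoin ℂ {algebraMap hol Mer L} := by
  obtain ⟨L, hL, hmem⟩ := exists_modularLambda_mem_levelField_two
  refine ⟨L, hL, le_antisymm ?_ ?_⟩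
  · -- every generator is `P(λ)/(λ(1-λ))^{2m}`
    refine IntermediateField.adjoin_le_iff.mpr ?_
    rintro u ⟨G, hGfi, m, F, hG, -, rfl⟩
    obtain ⟨P, -, hP⟩ := modFun_mul_pow_eq_polynomial hG F
    set lam : Mer := algebraMap hol Mer L with hlam
    have hlam_mem : lam ∈ IntermediateField.adjoin ℂ {lam} :=
      IntermediateField.subset_adjoin ℂ _ (Set.mem_singleton lam)
    -- `λ ≠ 0, 1` in `Mer`
    have hL0 : lam ≠ 0 := by
      rw [hlam, map_ne_zero_iff _ algebraMap_hol_injective]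
      intro h0
      have := congrArg (fun f : hol ↦ (f : ℍ → ℂ) UpperHalfPlane.I) h0
      simp only [hL, Subalgebra.coe_zero, Pi.zero_apply] at this
      exact modularLambda_ne_zero UpperHalfPlane.I.im_pos this
    have hL1 : 1 - lam ≠ 0 := by
      rw [hlam, ← map_one (algebraMap hol Mer), ← map_sub, map_ne_zero_iff _ algebraMap_hol_injective]
      intro h0
      have := congrArg (fun f : hol ↦ (f : ℍ → ℂ) UpperHalfPlane.I) h0
      simp only [Subalgebra.coe_sub, Subalgebra.coe_one, Pi.sub_apply, Pi.one_apply, hL,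
        Subalgebra.coe_zero, Pi.zero_apply, sub_eq_zero] at this
      exact modularLambda_ne_one UpperHalfPlane.I.im_pos this.symm
    -- the identity `u · (λ(1-λ))^{2m} = P(λ)` in `𝓗`, then in `Mer`
    have hidH : modFun m F * (L ^ (2 * m) * (1 - L) ^ (2 * m)) = Polynomial.aeval L P := by
      apply Subtype.ext
      funext τ
      have hev : ((Polynomial.aeval L P : hol) : ℍ → ℂ) τ = P.eval (modularLambda τ) := by
        change ((Pi.evalAlgHom ℂ (fun _ : ℍ ↦ ℂ) τ).comp hol.val) (Polynomial.aeval L P) = _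
        rw [← Polynomial.aeval_algHom_apply, Polynomial.coe_aeval_eq_eval]
        congr 1
        change (L : ℍ → ℂ) τ = modularLambda τ
        rw [hL]
      rw [hev, ← hP τ]
      simp only [Subalgebra.coe_mul, Subalgebra.coe_pow, Subalgebra.coe_sub, Subalgebra.coe_one,
        Pi.mul_apply, Pi.pow_apply, Pi.sub_apply, Pi.one_apply, hL]
    have hid : algebraMap hol Mer (modFun m F) * (lam ^ (2 * m) * (1 - lam) ^ (2 * m)) =
        algebraMap hol Mer (Polynomial.aeval L P) := by
      rw [← hidH, map_mul, map_mul, map_pow, map_pow, map_sub, map_one]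
    have hne : lam ^ (2 * m) * (1 - lam) ^ (2 * m) ≠ 0 :=
      mul_ne_zero (pow_ne_zero _ hL0) (pow_ne_zero _ hL1)
    rw [SetLike.mem_coe, eq_div_of_mul_eq hne hid]
    refine div_mem ?_ (mul_mem (pow_mem hlam_mem _) (pow_mem (sub_mem (one_mem _) hlam_mem) _))
    -- `P(λ) ∈ ℂ⟮λ⟯`
    rw [← Polynomial.aeval_algebraMap_apply]
    exact IntermediateField.algebra_adjoin_le_adjoin ℂ _
      (by rw [Algebra.adjoin_singleton_eq_range_aeval]; exact ⟨P, rfl⟩)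
  · exact IntermediateField.adjoin_le_iff.mpr (Set.singleton_subset_iff.mpr hmem)

/-- **`M_2` is finitely generated over `ℂ`** (by `λ`). [cite: CalegariDimitrovTang2025, §4.2
(`M_2 = ℚ(λ)`)] -/
theorem fg_levelField_two : (levelField 2).FG := by
  obtain ⟨L, -, hL⟩ := levelField_two_eq_adjoin
  rw [hL]
  exact IntermediateField.fg_adjoin_of_finite (Set.finite_singleton _)

end UnboundedDenominators


end Literature.NumberTheory.Automorphic

end
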